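import Summits.Langlands.Langlands.Theses.OrdinaryPrimeTransport
import Literature.NumberTheory.Automorphic.KimExteriorSquareGL4
import Literature.NumberTheory.Automorphic.GLnAdelicStructureProofs
import HarnessLib

/-!
# SKELETON — line `ExteriorSquareGL5GaloisToAutomorphic` for the crux `ReciprocityUpToIrreducibility`
# (item stmt-Langlands-14328; routes IrreducibilityBySelfDuality / OrdinaryPrimeTransport)
# forward generator G4 ladder-down, generation 14 (unit fwd2-ladder-Langlands-14328-g14)

Dial θ17 = the SOURCE RANK `m` of the exterior-square lift `∧² : GL_m → GL_{m(m-1)/2}` inside clause (B) of the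
top E = `ReciprocityUpToIrreducibility`, over EVERY number field.  Floor `m = 4` = Kim 2003 Thm A (in-tree named
fact `Kim2003_exteriorSquare_GL4`, `floor_four`); THE RUNG `m = 5` (`GL₅ → GL₁₀`) = `stub_rung`.

Five registered stubs and the kernel-checked composition `ReciprocityUpToIrreducibility_of` concluding the crux BY
NAME — TREE COPY: this file concludes route OrdinaryPrimeTransport's decl
`Summit.Langlands.Langlands.Theses.OrdinaryPrimeTransport.ReciprocityUpToIrreducibility` (the shared item stmt-Langlands-14328; the
IrreducibilityBySelfDuality decl is the same text verbatim — the REGISTERED skeleton (seat folder, `ledger skeleton check`) concludes that one;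
the IrreducibilityBySelfDuality Theses module does not elaborate on the crux-write host, as for g3–g13 and `directional_split`):

* `stub_floorFacts : WeakWedgeTexts` — the cells `m = 2, 3, 4` of the family as TEXTS in print (`∧² = det` on
  `GL₂`; `∧²π ≅ π^∨ ⊗ ω_π` on `GL₃`; Kim 2003 Thm A on `GL₄`, the in-tree named fact verbatim);
* `stub_rung : ExteriorSquareGL5GaloisToAutomorphic` — THE RUNG (first open cell, `m = 5`);
* `stub_higherRanks : HigherRanks` — the cells `m ≥ 6` (open; the rest of the graded family);
* `stub_sectorMerge : (∀ m ≥ 2, family m) → SectorGaloisToAutomorphic` — upgrade a.e.-Satake automorphy on the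
  `∧²`-sector to clause (B) of E verbatim (cuspidal, L-algebraic, `Corresponds` at every place, every `Rec`);
* `stub_offSector : OffSectorReciprocity` — E with clause (B) restricted OFF the `∧²`-sector (the honest complement).

Composition: `Rec` and clause (A) from `stub_offSector`; clause (B) by `by_cases InWedgeSector F ℓ ι ρ`.
Sorries ONLY inside the five `stub_*`.  Also recorded (sorry-free): `ExteriorSquareGL5GaloisToAutomorphic_of_top :
E → rung` (the rung is a consequence of the top, as of the summit).
-/

noncomputable section

set_option linter.dupNamespace false

open scoped MatrixGroups Matrix NumberField Classical Polynomial
open Filter IsDedekindDomain Field Polynomial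
open Literature.NumberTheory.Automorphic Literature.NumberTheory.GaloisRepresentations
open Literature.NumberTheory.PAdicHodge
open Summit.Langlands

namespace Summit.Langlands.Langlands.Cruxes.ReciprocityUpToIrreducibility.ExteriorSquareGL5GaloisToAutomorphic

/-! ## 1. Weak exterior-square lifts in the Borel–Jacquet datum model -/

/-- **`P` is an almost-everywhere exterior-square lift of `π`** (`t_{P,v} = ∧² t_{π,v}` for almost all `v`):
for all but finitely many finite places `v`, whenever `π` on `GL_m(𝔸_F)` has Satake parameter `α` at `v`,
`P` on `GL_{m(m-1)/2}(𝔸_F)` has Satake parameter `wedgeTwoParams α = {αᵢαⱼ : i < j}` at `v`.  Same design as the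
first clause of `Kim2003_exteriorSquare_GL4` and as `IsSymmSqLiftAE` (Gelbart–Jacquet file). [cite: Kim2002, Theorem A] -/
def IsWedgeTwoLiftAE (m : ℕ) {F : Type} [Field F] [NumberField F]
    {hm : isCompact_glFiniteIntegralLevel m F} {hN : isCompact_glFiniteIntegralLevel (m * (m - 1) / 2) F}
    (π : AutomorphicRepData (AutomorphyDatum.gl m F hm))
    (P : AutomorphicRepData (AutomorphyDatum.gl (m * (m - 1) / 2) F hN)) : Prop :=
  ∀ᶠ v : HeightOneSpectrum (𝓞 F) in cofinite, ∀ α : Multiset ℂ,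
    π.HasSatakeParamAt v α → P.HasSatakeParamAt v (wedgeTwoParams α)

/-- **Weak `∧²` functoriality `GL_m → GL_{m(m-1)/2}` over every number field** (the text family of which
Kim 2003 Thm A is `m = 4`; `m = 2` (`∧² = det`) and `m = 3` (`∧²π ≅ π^∨ ⊗ ω_π`) are elementary in print; `m ≥ 5` is
OPEN): every cuspidal `π` on `GL_m(𝔸_F)` has an a.e. `∧²`-lift which is an automorphic representation of
`GL_{m(m-1)/2}(𝔸_F)` (Borel–Jacquet datum, not asserted cuspidal). -/
def WeakExteriorSquareFunctoriality (m : ℕ) : Prop :=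
  ∀ (F : Type) [Field F] [NumberField F] (hm : isCompact_glFiniteIntegralLevel m F)
    (hN : isCompact_glFiniteIntegralLevel (m * (m - 1) / 2) F) (π : CuspidalAutomorphicRepData m F hm),
    ∃ P : AutomorphicRepData (AutomorphyDatum.gl (m * (m - 1) / 2) F hN), IsWedgeTwoLiftAE m π.1 P

/-! ## 2. The graded family (dial = source rank `m` of `∧²`, target rank `m(m-1)/2`) and the rung `m = 5` -/

/-- **The rung family** `ExteriorSquareGaloisToAutomorphic m`: clause (B) of the summit (Galois ⇒ automorphic) over
EVERY number field `F`, at EVERY `ℓ` and `ι : ℚ̄_ℓ ≃ ℂ`, in the a.e.-Satake form, for irreducible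
`ρ : Γ_F → GL_{m(m-1)/2}(ℚ̄_ℓ)` de Rham above `ℓ` (pinned Fontaine datum `fontainePstAdicCompletion`) whose Frobenius
characteristic polynomials are, at all but finitely many places, the `ι`-Satake polynomials of `∧² α_v` for the
Satake parameters `α_v` of a CUSPIDAL `π` on `GL_m(𝔸_F)` — the unramified shadow of "`ρ ≅ ∧² ρ_π`".
Conclusion: an AUTOMORPHIC `P` on `GL_{m(m-1)/2}(𝔸_F)` (Borel–Jacquet datum, not asserted cuspidal) with
`SatakeFrobCompatibleAt ι P ρ v` for almost all `v`.  Implied by the summit for every `m ≥ 2`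
(`exteriorSquareGaloisToAutomorphic_of_langlands`); implied by weak `∧²` functoriality at `m`
(`of_weakExteriorSquareFunctoriality`), hence PROVED at `m = 4` modulo the in-tree named fact (Kim 2003 Thm A) and
elementary at `m = 2, 3`; OPEN at `m = 5` (`GL₅ → GL₁₀`). -/
def ExteriorSquareGaloisToAutomorphic (m : ℕ) : Prop :=
  ∀ (F : Type) [Field F] [NumberField F]
    (hm : Literature.NumberTheory.Automorphic.isCompact_glFiniteIntegralLevel m F)
    (π : Literature.NumberTheory.Automorphic.CuspidalAutomorphicRepData m F hm)
    (ℓ : ℕ) [Fact ℓ.Prime] (ι : PadicAlgCl ℓ ≃+* ℂ)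
    (ρ : Literature.NumberTheory.GaloisRepresentations.FramedGaloisRep F (PadicAlgCl ℓ) (m * (m - 1) / 2)),
    ρ.toGaloisRep.IsIrreducible →
    (∀ (v : IsDedekindDomain.HeightOneSpectrum (NumberField.RingOfIntegers F))
      (hv : ((ℓ : ℕ) : NumberField.RingOfIntegers F) ∈ v.asIdeal),
      (Literature.NumberTheory.PAdicHodge.fontainePstAdicCompletion v ℓ hv).IsDeRhamFramed (ρ.toLocal v)) →
    (∀ᶠ v : IsDedekindDomain.HeightOneSpectrum (NumberField.RingOfIntegers F) in Filter.cofinite,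
      ∃ α : Multiset ℂ, π.1.HasSatakeParamAt v α ∧ ρ.IsUnramifiedAt v ∧
        ρ.HasFrobCharpolyAt v
          (Literature.NumberTheory.Automorphic.arithFrobPolyOfSatake ι v.residueCard 1
            (Literature.NumberTheory.Automorphic.wedgeTwoParams α))) →
    ∀ hcpt : Literature.NumberTheory.Automorphic.isCompact_glFiniteIntegralLevel (m * (m - 1) / 2) F,
      ∃ P : Literature.NumberTheory.Automorphic.AutomorphicRepData
          (Literature.NumberTheory.Automorphic.AutomorphyDatum.gl (m * (m - 1) / 2) F hcpt),
        ∀ᶠ v : IsDedekindDomain.HeightOneSpectrum (NumberField.RingOfIntegers F) in Filter.cofinite,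
          Summit.Langlands.SatakeFrobCompatibleAt ι P ρ v

/-- **THE RUNG** (the filed statement): the family at `m = 5` — clause (B) for irreducible de Rham
`GL₁₀`-representations of exterior-square-of-`GL₅` type over every number field. -/
def ExteriorSquareGL5GaloisToAutomorphic : Prop := ExteriorSquareGaloisToAutomorphic 5

/-! ## 3. Weak functoriality at `m` gives the rung family at `m` -/

/-- **`WeakExteriorSquareFunctoriality m → ExteriorSquareGaloisToAutomorphic m`**: the automorphic a.e. `∧²`-lift
`P` of `π` has, at almost every `v`, the Satake parameter `∧² α_v`, which is what the sector clause says
`ρ(Frob_v)` has as inverse-root data. [folklore] -/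
theorem of_weakExteriorSquareFunctoriality {m : ℕ} (h : WeakExteriorSquareFunctoriality m) :
    ExteriorSquareGaloisToAutomorphic m := by
  intro F _ _ hm π ℓ _ ι ρ _hirr _hdR hsec hcpt
  obtain ⟨P, hP⟩ := h F hm hcpt π
  refine ⟨P, ?_⟩
  have hP' : ∀ᶠ v : HeightOneSpectrum (𝓞 F) in cofinite, ∀ α : Multiset ℂ,
      π.1.HasSatakeParamAt v α → P.HasSatakeParamAt v (wedgeTwoParams α) := hP
  filter_upwards [hsec, hP'] with v hv hPv
  obtain ⟨α, hπ, hur, hcp⟩ := hv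
  exact ⟨wedgeTwoParams α, hPv α hπ, hur, hcp⟩

/-! ## 4. The floor `m = 4` (Kim 2003 Theorem A, IN TREE as a named fact) -/

/-- **Kim 2003 Thm A gives weak `∧²` functoriality at `m = 4`** (target rank `4 * 3 / 2 = 6` by `rfl`; the
standing compactness facts are propositions, so Kim's uniform family `hF` is supplied by
`isCompact_glFiniteIntegralLevel_holds`). [cite: Kim2002, Theorem A (p. 139) and Thm. 5.3.1 (p. 165)] -/
theorem weakExteriorSquareFunctoriality_four (h : Kim2003_exteriorSquare_GL4) :
    WeakExteriorSquareFunctoriality 4 := by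
  intro F _ _ h4 h6 π
  obtain ⟨P, hP⟩ := Kim2003_exteriorSquare_GL4.exists_weakLift h F
    (fun k => isCompact_glFiniteIntegralLevel_holds k F) π
  exact ⟨P, hP⟩

/-- **THE FLOOR of the ladder (`m = 4`, PROVED modulo the in-tree named fact)**: clause (B) for irreducible
de Rham `ρ : Γ_F → GL₆(ℚ̄_ℓ)` of exterior-square-of-`GL₄` type, over every number field — Kim 2003 Theorem A.
[cite: Kim2002, Theorem A] -/
theorem floor_four (h : Kim2003_exteriorSquare_GL4) : ExteriorSquareGaloisToAutomorphic 4 :=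
  of_weakExteriorSquareFunctoriality (weakExteriorSquareFunctoriality_four h)


/-! ## 5. The sector, its merge target and the off-sector complement -/

/-- **The `∧²`-sector of clause (B)**: `ρ : Γ_F → GL_n(ℚ̄_ℓ)` is of exterior-square type — `n = m(m-1)/2` for some
`m ≥ 2` and there is a cuspidal `π` on `GL_m(𝔸_F)` such that, at almost every place, `ρ` is unramified with
Frobenius characteristic polynomial the `ι`-Satake polynomial of `∧²` of the Satake parameter of `π`.
(No cast on `ρ` is needed: `HasFrobCharpolyAt` takes any polynomial.) -/
def InWedgeSector (F : Type) [Field F] [NumberField F] (ℓ : ℕ) [Fact ℓ.Prime] (ι : PadicAlgCl ℓ ≃+* ℂ)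
    {n : ℕ} (ρ : FramedGaloisRep F (PadicAlgCl ℓ) n) : Prop :=
  ∃ m : ℕ, 2 ≤ m ∧ n = m * (m - 1) / 2 ∧
    ∃ (hm : isCompact_glFiniteIntegralLevel m F) (π : CuspidalAutomorphicRepData m F hm),
      ∀ᶠ v : HeightOneSpectrum (𝓞 F) in cofinite,
        ∃ α : Multiset ℂ, π.1.HasSatakeParamAt v α ∧ ρ.IsUnramifiedAt v ∧
          ρ.HasFrobCharpolyAt v (arithFrobPolyOfSatake ι v.residueCard 1 (wedgeTwoParams α))

/-- **Merge target**: clause (B) of E VERBATIM (cuspidal, L-algebraic, `Corresponds Rec ι π ρ` — a.e. Satake AND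
`LocalGlobalCompatibleAt` at every finite place) for EVERY reciprocity datum `Rec`, on the `∧²`-sector. -/
def SectorGaloisToAutomorphic : Prop :=
  ∀ (F : Type) [Field F] [NumberField F] (Rec : ReciprocityData F) (n : ℕ), 0 < n →
    ∀ (hcpt : isCompact_glFiniteIntegralLevel n F) (ℓ : ℕ) [Fact ℓ.Prime] (ι : PadicAlgCl ℓ ≃+* ℂ)
      (ρ : FramedGaloisRep F (PadicAlgCl ℓ) n),
      ρ.toGaloisRep.IsIrreducible → IsGeometricFramed Rec ρ → InWedgeSector F ℓ ι ρ →
        ∃ π : CuspidalAutomorphicRepData n F hcpt, π.1.IsLAlgebraic ∧ Corresponds Rec ι π.1 ρ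

/-- **The off-sector complement**: E (`ReciprocityUpToIrreducibility`) with clause (A) entire and clause (B)
restricted to `ρ` NOT in the `∧²`-sector. -/
def OffSectorReciprocity : Prop :=
  ∀ (F : Type) [Field F] [NumberField F], ∃ Rec : ReciprocityData F, ∀ n : ℕ, 0 < n →
    ∀ hcpt : isCompact_glFiniteIntegralLevel n F,
      (∀ π : CuspidalAutomorphicRepData n F hcpt, π.1.IsLAlgebraic →
        ∀ (ℓ : ℕ) [Fact ℓ.Prime] (ι : PadicAlgCl ℓ ≃+* ℂ),
          ∃ ρ : FramedGaloisRep F (PadicAlgCl ℓ) n, IsGeometricFramed Rec ρ ∧ Corresponds Rec ι π.1 ρ) ∧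
      (∀ (ℓ : ℕ) [Fact ℓ.Prime] (ι : PadicAlgCl ℓ ≃+* ℂ) (ρ : FramedGaloisRep F (PadicAlgCl ℓ) n),
        ρ.toGaloisRep.IsIrreducible → IsGeometricFramed Rec ρ → ¬ InWedgeSector F ℓ ι ρ →
          ∃ π : CuspidalAutomorphicRepData n F hcpt, π.1.IsLAlgebraic ∧ Corresponds Rec ι π.1 ρ)

/-- **The floor cells as texts**: weak `∧²` functoriality at `m = 2` (`∧² = det`: the central character as an
automorphic representation of `GL₁`), at `m = 3` (`∧²π ≅ π^∨ ⊗ ω_π`), and Kim 2003 Thm A at `m = 4` (the in-tree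
named fact verbatim). [cite: Kim2002, Theorem A] -/
def WeakWedgeTexts : Prop :=
  WeakExteriorSquareFunctoriality 2 ∧ WeakExteriorSquareFunctoriality 3 ∧ Kim2003_exteriorSquare_GL4

/-- **The higher rungs** of the graded family: `m ≥ 6` (all open). -/
def HigherRanks : Prop := ∀ m : ℕ, 6 ≤ m → ExteriorSquareGaloisToAutomorphic m

/-! ## 6. The five registered stubs -/

/-- Floor cells `m = 2, 3, 4` — theorems in print (elementary; elementary; Kim 2003 Thm A). [cite: Kim2002, Theorem A] -/
theorem stub_floorFacts : WeakWedgeTexts := by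
  sorry

/-- **THE RUNG** `m = 5`: clause (B), a.e.-Satake form, for irreducible de Rham `ρ : Γ_F → GL₁₀(ℚ̄_ℓ)` of
`∧²(GL₅)`-type over every number field.  OPEN (Langlands–Shahidi + converse theorem stop at `m = 4`). -/
theorem stub_rung : ExteriorSquareGL5GaloisToAutomorphic := by
  sorry

/-- The cells `m ≥ 6` of the family (open). -/
theorem stub_higherRanks : HigherRanks := by
  sorry

/-- Sector merge: from a.e.-Satake automorphy on the whole `∧²`-sector (all `m ≥ 2`) to clause (B) of E verbatim on
the sector, for every `Rec` (isobaric rigidity ⇒ cuspidal; L-algebraicity; local–global compatibility at every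
finite place, the `v ∣ ℓ` clause against the pinned Fontaine datum). -/
theorem stub_sectorMerge :
    (∀ m : ℕ, 2 ≤ m → ExteriorSquareGaloisToAutomorphic m) → SectorGaloisToAutomorphic := by
  sorry

/-- The honest complement: E off the `∧²`-sector. -/
theorem stub_offSector : OffSectorReciprocity := by
  sorry

/-! ## 7. Composition (no sorry below this line) -/

/-- The whole graded family from the floor texts, the rung and the higher rungs. -/
theorem family_of (hT : WeakWedgeTexts) (h5 : ExteriorSquareGL5GaloisToAutomorphic) (h6 : HigherRanks)
    (m : ℕ) (hm : 2 ≤ m) : ExteriorSquareGaloisToAutomorphic m := by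
  obtain ⟨h2, h3, h4⟩ := hT
  by_cases h6m : 6 ≤ m
  · exact h6 m h6m
  · interval_cases m
    · exact of_weakExteriorSquareFunctoriality h2
    · exact of_weakExteriorSquareFunctoriality h3
    · exact floor_four h4
    · exact h5

/-- **COMPOSITION — the crux BY NAME from the five stub statements.**  `Rec` and clause (A) come from the
off-sector statement; clause (B) is a case split on the `∧²`-sector. -/
theorem ReciprocityUpToIrreducibility_of :
    WeakWedgeTexts → ExteriorSquareGL5GaloisToAutomorphic → HigherRanks →
    ((∀ m : ℕ, 2 ≤ m → ExteriorSquareGaloisToAutomorphic m) → SectorGaloisToAutomorphic) →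
    OffSectorReciprocity →
    Summit.Langlands.Langlands.Theses.OrdinaryPrimeTransport.ReciprocityUpToIrreducibility := by
  intro hT h5 h6 hmerge hoff F _ _
  obtain ⟨Rec, hall⟩ := hoff F
  refine ⟨Rec, fun n hn hcpt => ⟨(hall n hn hcpt).1, ?_⟩⟩
  intro ℓ _ ι ρ hirr hgeo
  by_cases hsec : InWedgeSector F ℓ ι ρ
  · exact hmerge (family_of hT h5 h6) F Rec n hn hcpt ℓ ι ρ hirr hgeo hsec
  · exact (hall n hn hcpt).2 ℓ ι ρ hirr hgeo hsec

/-- The crux from the REGISTERED stubs (audit: proof-of-item modulo the five sorries). -/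
theorem reciprocityUpToIrreducibility_of_stubs :
    Summit.Langlands.Langlands.Theses.OrdinaryPrimeTransport.ReciprocityUpToIrreducibility :=
  ReciprocityUpToIrreducibility_of stub_floorFacts stub_rung stub_higherRanks stub_sectorMerge stub_offSector

/-! ## 8. The rung is a consequence of the top (sorry-free) -/

/-- `E → ExteriorSquareGaloisToAutomorphic m` for every `m ≥ 2` (clause (B) of E for its own `Rec`). -/
theorem exteriorSquareGaloisToAutomorphic_of_top (m : ℕ) (hm : 2 ≤ m)
    (hE : Summit.Langlands.Langlands.Theses.OrdinaryPrimeTransport.ReciprocityUpToIrreducibility) :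
    ExteriorSquareGaloisToAutomorphic m := by
  intro F _ _ hmF π ℓ _ ι ρ hirr hdR hsec hcpt
  obtain ⟨Rec, hall⟩ := hE F
  have hpos : 0 < m * (m - 1) / 2 := by
    obtain ⟨k, rfl⟩ : ∃ k, m = k + 2 := ⟨m - 2, by omega⟩
    have h1 : (k + 2) * (k + 2 - 1) = (k + 2) * (k + 1) := by congr 1
    rw [h1]
    apply Nat.div_pos _ two_pos
    nlinarith
  have hB : GaloisToAutomorphic (m * (m - 1) / 2) Rec hcpt := (hall (m * (m - 1) / 2) hpos hcpt).2
  have hgeo : IsGeometricFramed Rec ρ :=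
    ⟨hsec.mono fun v ⟨_, _, hur, _⟩ => hur, fun v hv => hdR v hv⟩
  obtain ⟨π', -, hcorr⟩ := hB ℓ ι ρ hirr hgeo
  exact ⟨π'.1, hcorr.1⟩

/-- `E → rung`. -/
theorem ExteriorSquareGL5GaloisToAutomorphic_of_top
    (hE : Summit.Langlands.Langlands.Theses.OrdinaryPrimeTransport.ReciprocityUpToIrreducibility) :
    ExteriorSquareGL5GaloisToAutomorphic :=
  exteriorSquareGaloisToAutomorphic_of_top 5 (by norm_num) hE

end Summit.Langlands.Langlands.Cruxes.ReciprocityUpToIrreducibility.ExteriorSquareGL5GaloisToAutomorphic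

end
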